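import Literature.RepresentationTheory.GeneralLinear.SL2TripleDoubleCommutant
import Literature.AlgebraicGeometry.Motives.HodgeLieWeightOneRankThree
import Literature.AlgebraicGeometry.Motives.HodgeThetaSubalgebraRealPlacesSl2
import HarnessLib

/-!
# Complex spans of rational Lie algebras inside `𝔰𝔭_{End_Hdg}(V, ψ)` in Hodge-group rank three lie in `ℂΘ′ ⊕ ℂE ⊕ ℂF`
# (Murty 1984: `hg(A) = {m ∈ End_{End A}(W) : tr m = 0}`; Moonen–Zarhin 1999 §2)

Family `hodge`, layer `Literature/AlgebraicGeometry/Motives` (abstract polarizable `ℚ`-Hodge structures; no geometry).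
Written for the cell `pub-hodgecm2` (COR-CM), seat `b27`, count-neutral lane MT-RANK-FOUR-DIVISORS (sequel of the
MT-rank ladder MT-RANK-FOUR: `HodgeLieRankLowerBound`, `HodgeLieWeightOneSl2Triple`, `HodgeLieWeightOneRankThree`);
UNCONDITIONAL linear algebra of Hodge structures, no step towards a summit statement.  First half of the rank-three
`Θ`-subalgebra theorem (`Motives/HodgeThetaSubalgebraRankThree`), the analogue of the tree's real-multiplication file
`Motives/HodgeThetaSubalgebraRealPlacesSl2` (cell `pub-hodge-ring2`), whose `spanC` vocabulary it reuses BY NAME.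

SETTING.  `H` an effective polarizable `ℚ`-Hodge structure of weight `1` on a finite-dimensional `V`, `ψ` a
polarization, `dim_ℚ Lie Hg(H) ≤ 3` and some `X ∈ Lie Hg(H) ∖ End_Hdg(V)` — the Hodge structure `H¹` of a complex abelian
variety NOT of CM type with `dim MT(H¹) ≤ 4` (Moonen–Zarhin 1999 §2: Type I(1) `Hg = SL₂`, Type II(1) `Hg = SL₁(D)`).  In a
graded basis `e` of `V_ℂ` with grading projector `P` onto `V^{1,0}`: `Lie Hg ⊗ ℂ = ℂΘ′ ⊕ ℂE ⊕ ℂF`, `Θ′ = 2P − 1`,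
`E = P X_ℂ (1 − P)`, `F = (1 − P) X_ℂ P`, `E F = α P`, `F E = α (1 − P)`, `α ≠ 0`, and `End_Hdg(V) ⊗ ℂ` is the commutant of
`{P, E, F}` (`exists_coeffs_of_mem_hodgeLieC`, `exists_projE_mul_projF_eq_smul`, `mem_span_endAlg_iff_commute`).

MAIN RESULTS (all proved; no definition, no named fact, D-0026):
* §0 `HodgeStructure.commutator_mem_spanC` — the complex span `spanC 𝔤` of a bracket-closed rational subspace
  `𝔤 ⊆ End_ℚ V` is bracket-closed; `HodgeStructure.conjOp_mem_spanC` — it is stable under `Y ↦ conj ∘ Y ∘ conj`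
  (the real structure `End_ℂ(V_ℂ) = End_ℚ(V) ⊗ ℂ`, Deligne Hodge II 2.1.4).
* §1 **`HodgeStructure.exists_coeffs_of_mem_spanC_of_commute_of_skew`** — for a rational subspace `𝔞 ⊆ End_ℚ V` of
  operators commuting with `End_Hdg(V)` and skew for `ψ`, every `Z ∈ 𝔞_ℂ` is `c₀ Θ′ + c₁ E + c₂ F`: `Z` commutes with
  `End_Hdg ⊗ ℂ = commutant{P, E, F}`, so lies in `ℂP ⊕ ℂ(1 − P) ⊕ ℂE ⊕ ℂF` by the double commutant theorem
  (`SL2Triple.exists_eq_of_forall_commute_commutant`), and skewness of `Z, Θ′, E, F` kills the component along `1`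
  (second Hodge–Riemann relation at a vector of `V^{1,0}`).  Murty (Gordon §7.3.2): "`hg(A) = {m ∈ End_{End A}(W) :
  tr_R m = 0}` … over `ℂ` it is a product of `𝔰𝔩₂`'s".

## References

* [Gordon1997] B. B. Gordon, *A survey of the Hodge conjecture for abelian varieties*, App. B of Lewis, CRM Monogr.
  Ser. 10 (1999) = arXiv:alg-geom/9709030 (held `paper:arxiv-alg-geom_9709030`), §7.3.2, Thm. 7.5.
* [MoonenZarhin1999LowDim] B. Moonen, Yu. Zarhin, *Hodge classes on abelian varieties of low dimension*, Math. Ann.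
  315 (1999) 711–733, §2 (2.1)–(2.2).
* [Deligne1982HodgeCycles] P. Deligne, *Hodge cycles on abelian varieties*, LNM 900 (1982), I §3 (proof of Prop. 3.4).
* [DeligneHodgeII1971] P. Deligne, *Théorie de Hodge II*, Publ. Math. IHÉS 40 (1971), 2.1.4 (real structure).
* [Huybrechts2016K3] D. Huybrechts, *Lectures on K3 Surfaces* (2016), §3.3.4 (commutant of the Hodge group).
* [FultonHarris1991] W. Fulton, J. Harris, *Representation Theory*, GTM 129 (1991), Lecture 11 (§11.1).
-/

noncomputable section

open scoped TensorProduct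

namespace Literature.AlgebraicGeometry.Motives

namespace HodgeStructure

open Literature.RepresentationTheory.GeneralLinear

universe u

variable {V : Type u} [AddCommGroup V] [Module ℚ V] [Module.Finite ℚ V] [HodgeTensorFacts.{u, u}] {n : ℤ}
  {S : Type u} [Fintype S] [DecidableEq S] {deg : S → ℤ}

/-! ### §0 Generic facts on complex spans of rational subspaces -/

omit [Module.Finite ℚ V] [HodgeTensorFacts.{u, u}] in
/-- **The complex span of a bracket-closed rational subspace is bracket-closed.** [cite: Deligne1982HodgeCycles, I §3 (proof of Prop. 3.4)] -/
theorem commutator_mem_spanC {𝔤 : Submodule ℚ (Module.End ℚ V)}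
    (hbr : ∀ X ∈ 𝔤, ∀ Y ∈ 𝔤, X * Y - Y * X ∈ 𝔤) {Y Z : Module.End ℂ (ℂ ⊗[ℚ] V)}
    (hY : Y ∈ spanC 𝔤) (hZ : Z ∈ spanC 𝔤) : Y * Z - Z * Y ∈ spanC 𝔤 := by
  induction hY using Submodule.span_induction generalizing Z with
  | mem Y' hY' =>
    obtain ⟨X, hX, rfl⟩ := hY'
    induction hZ using Submodule.span_induction with
    | mem Z' hZ' =>
      obtain ⟨X', hX', rfl⟩ := hZ'
      rw [← LinearMap.baseChange_mul, ← LinearMap.baseChange_mul, ← LinearMap.baseChange_sub]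
      exact baseChange_mem_spanC (hbr X hX X' hX')
    | zero => rw [mul_zero, zero_mul, sub_zero]; exact Submodule.zero_mem _
    | add Z₁ Z₂ _ _ h₁ h₂ =>
      have h : X.baseChange ℂ * (Z₁ + Z₂) - (Z₁ + Z₂) * X.baseChange ℂ =
          (X.baseChange ℂ * Z₁ - Z₁ * X.baseChange ℂ) + (X.baseChange ℂ * Z₂ - Z₂ * X.baseChange ℂ) := by
        rw [mul_add, add_mul]; abel
      rw [h]; exact Submodule.add_mem _ h₁ h₂
    | smul c Z₁ _ h₁ =>
      rw [mul_smul_comm, smul_mul_assoc, ← smul_sub]; exact Submodule.smul_mem _ c h₁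
  | zero => rw [zero_mul, mul_zero, sub_zero]; exact Submodule.zero_mem _
  | add Y₁ Y₂ _ _ h₁ h₂ =>
    have h : (Y₁ + Y₂) * Z - Z * (Y₁ + Y₂) = (Y₁ * Z - Z * Y₁) + (Y₂ * Z - Z * Y₂) := by
      rw [add_mul, mul_add]; abel
    rw [h]; exact Submodule.add_mem _ (h₁ hZ) (h₂ hZ)
  | smul c Y₁ _ h₁ =>
    rw [smul_mul_assoc, mul_smul_comm, ← smul_sub]; exact Submodule.smul_mem _ c (h₁ hZ)

omit [Module.Finite ℚ V] [HodgeTensorFacts.{u, u}] in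
/-- **The complex span of a rational subspace is stable under `Y ↦ conj ∘ Y ∘ conj`** (the real structure of
`End_ℂ(V_ℂ) = End_ℚ(V) ⊗ ℂ`: `conj ∘ X_ℂ ∘ conj = X_ℂ` for rational `X`, `conj_baseChange`).
[cite: DeligneHodgeII1971, 2.1.4] -/
theorem conjOp_mem_spanC {𝔤 : Submodule ℚ (Module.End ℚ V)} {Y : Module.End ℂ (ℂ ⊗[ℚ] V)}
    (hY : Y ∈ spanC 𝔤) {Yb : Module.End ℂ (ℂ ⊗[ℚ] V)} (hYb : ∀ v, Yb v = conj (Y (conj v))) :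
    Yb ∈ spanC 𝔤 := by
  induction hY using Submodule.span_induction generalizing Yb with
  | mem Y' hY' =>
    obtain ⟨X, hX, rfl⟩ := hY'
    have h : Yb = X.baseChange ℂ := LinearMap.ext fun v => by rw [hYb, conj_baseChange, conj_conj]
    rw [h]; exact baseChange_mem_spanC hX
  | zero =>
    have h : Yb = 0 := LinearMap.ext fun v => by rw [hYb, LinearMap.zero_apply, map_zero, LinearMap.zero_apply]
    rw [h]; exact Submodule.zero_mem _
  | add Y₁ Y₂ _ _ h₁ h₂ =>
    obtain ⟨Yb₁, hYb₁⟩ := exists_conjOp Y₁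
    obtain ⟨Yb₂, hYb₂⟩ := exists_conjOp Y₂
    have h : Yb = Yb₁ + Yb₂ := LinearMap.ext fun v => by
      rw [hYb, LinearMap.add_apply, map_add, LinearMap.add_apply, hYb₁, hYb₂]
    rw [h]; exact Submodule.add_mem _ (h₁ hYb₁) (h₂ hYb₂)
  | smul c Y₁ _ h₁ =>
    obtain ⟨Yb₁, hYb₁⟩ := exists_conjOp Y₁
    have h : Yb = (starRingEnd ℂ c) • Yb₁ := LinearMap.ext fun v => by
      rw [hYb, LinearMap.smul_apply, conj_smul, LinearMap.smul_apply, hYb₁]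
    rw [h]; exact Submodule.smul_mem _ _ (h₁ hYb₁)

/-! ### §1 The complex span of `𝔞` lies in `ℂΘ′ ⊕ ℂE ⊕ ℂF` -/

/-- **Every element of `𝔞_ℂ` is a combination of `Θ′ = 2P − 1`, `E`, `F`**, for a rational subspace `𝔞 ⊆ End_ℚ V`
of operators commuting with `End_Hdg(V)` and skew for a polarization `ψ` (weight one, `dim Lie Hg ≤ 3`,
`Lie Hg ⊄ End_Hdg`).  An element `Z ∈ 𝔞_ℂ` commutes with `End_Hdg(V) ⊗ ℂ`, which is the commutant of the triple
`(P, E, F)` (`mem_span_endAlg_iff_commute`), so `Z ∈ ℂP ⊕ ℂ(1 − P) ⊕ ℂE ⊕ ℂF` by the double commutant theorem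
(`SL2Triple.exists_eq_of_forall_commute_commutant`); skewness of `Z`, `Θ′`, `E`, `F` kills the component along `1`
(second Hodge–Riemann relation at a vector of `V^{1,0}`).  Murty: "`hg(A) = {m ∈ End_{End A}(W) : tr m = 0}`".
[cite: MoonenZarhin1999LowDim, §2] [cite: Gordon1997, §7.3.2 (after Murty 1984)] -/
theorem exists_coeffs_of_mem_spanC_of_commute_of_skew (H : HodgeStructure V n) (ψ : H.Polarization) (hn : n = 1)
    (hH : H.IsEffective) (e : Module.Basis S ℂ (ℂ ⊗[ℚ] V))
    (hF : ∀ a, H.F a = Submodule.span ℂ (e '' {σ | a ≤ deg σ}))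
    (hFc : ∀ a, complexConj (H.F a) = Submodule.span ℂ (e '' {σ | deg σ ≤ n - a}))
    {X : Module.End ℚ V} (hX : X ∈ H.hodgeLie) (hXE : X ∉ H.endAlg) (h3 : Module.finrank ℚ H.hodgeLie ≤ 3)
    {𝔞 : Submodule ℚ (Module.End ℚ V)} (hcomm : ∀ X' ∈ 𝔞, ∀ a : H.endAlg, X' * (a : Module.End ℚ V) = a * X')
    (hskew : ∀ X' ∈ 𝔞, ∀ v w, ψ.form (X' v) w + ψ.form v (X' w) = 0)
    {Z : Module.End ℂ (ℂ ⊗[ℚ] V)} (hZ : Z ∈ spanC 𝔞) :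
    ∃ c : Fin 3 → ℂ, Z = c 0 • ((2 : ℂ) • gradingEnd e deg - 1) +
      c 1 • (gradingEnd e deg * X.baseChange ℂ * (1 - gradingEnd e deg)) +
      c 2 • ((1 - gradingEnd e deg) * X.baseChange ℂ * gradingEnd e deg) := by
  classical
  have hdeg : ∀ σ, deg σ = 0 ∨ deg σ = 1 := fun σ => by
    have h := hH.deg_mem_Icc_of_graded e hF hFc σ
    rw [hn] at h
    omega
  obtain ⟨α, hα, hEF, hFE⟩ := exists_projE_mul_projF_eq_smul H ψ hn e hF hFc hdeg hX hXE h3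
  obtain ⟨hE0, -⟩ := projE_ne_zero_of_not_mem_endAlg H hn e hF hFc hdeg hXE
  have hC := mem_span_endAlg_iff_commute H hn e hF hFc hdeg hX hXE h3
  subst hn
  set P := gradingEnd e deg with hP
  set Y := X.baseChange ℂ with hY
  set E := P * Y * (1 - P) with hEdef
  set F := (1 - P) * Y * P with hFdef
  have hPP : P * P = P := gradingEnd_mul_gradingEnd_of_deg e hdeg
  have hPE : P * E = E := by rw [hEdef, ← mul_assoc, ← mul_assoc, hPP]
  have hEP : E * P = 0 := by rw [hEdef, mul_assoc (P * Y) (1 - P) P, sub_mul, one_mul, hPP, sub_self, mul_zero]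
  have hPF : P * F = 0 := by
    rw [hFdef, mul_assoc (1 - P) Y P, ← mul_assoc P (1 - P) (Y * P), mul_sub, mul_one, hPP, sub_self, zero_mul]
  have hFP : F * P = F := by rw [hFdef, mul_assoc ((1 - P) * Y) P P, hPP]
  -- `Z` commutes with the commutant of `(P, E, F)`, which is `End_Hdg ⊗ ℂ`
  have hZC : ∀ T ∈ Submodule.span ℂ ((fun a : Module.End ℚ V => a.baseChange ℂ) '' (H.endAlg : Set (Module.End ℚ V))),
      Z * T = T * Z := by
    intro T hT
    induction hT using Submodule.span_induction with
    | mem T' hT' =>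
      obtain ⟨a, ha, rfl⟩ := hT'
      symm
      refine commute_of_mem_spanC (fun X' hX' => ?_) hZ
      rw [← LinearMap.baseChange_mul, ← hcomm X' hX' ⟨a, ha⟩, LinearMap.baseChange_mul]
    | zero => rw [mul_zero, zero_mul]
    | add T₁ T₂ _ _ h₁ h₂ => rw [mul_add, add_mul, h₁, h₂]
    | smul c T₁ _ h₁ => rw [mul_smul_comm, smul_mul_assoc, h₁]
  obtain ⟨c, hc⟩ := SL2Triple.exists_eq_of_forall_commute_commutant hα hPP hPE hEP hPF hFP hEF hFE hC hZC
  -- skewness kills the component along `1`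
  have hΘ'M : (2 : ℂ) • P - 1 ∈ H.hodgeLieC := by
    have h := two_smul_gradingEnd_sub_mem_hodgeLieC H e hF hFc
    rw [Int.cast_one, one_smul] at h
    exact h
  obtain ⟨hEM, hFM⟩ := projE_mem_hodgeLieC H e hF hFc hdeg (H.baseChange_mem_hodgeLieC hX)
  rw [← hP, ← hY, ← hEdef] at hEM
  rw [← hP, ← hY, ← hFdef] at hFM
  set W := ((c 0 - c 1) / 2) • ((2 : ℂ) • P - 1) + c 2 • E + c 3 • F with hW
  have hWM : W ∈ H.hodgeLieC :=
    Submodule.add_mem _ (Submodule.add_mem _ (Submodule.smul_mem _ _ hΘ'M) (Submodule.smul_mem _ _ hEM))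
      (Submodule.smul_mem _ _ hFM)
  have hZW : Z = ((c 0 + c 1) / 2) • (1 : Module.End ℂ (ℂ ⊗[ℚ] V)) + W := by
    rw [hc, hW, smul_sub, smul_sub, smul_smul]
    module
  have hZW' : ∀ v, Z v = ((c 0 + c 1) / 2) • v + W v := fun v => by
    rw [hZW, LinearMap.add_apply, LinearMap.smul_apply, Module.End.one_apply]
  -- a vector of `V^{1,0}` on which `ψ_ℂ(x, conj x) ≠ 0`
  obtain ⟨σ₁, hσ₁⟩ : ∃ σ, deg σ = 1 := by
    by_contra h
    push Not at h
    apply hE0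
    have hP0 : P = 0 := e.ext fun σ => by
      rw [hP, gradingEnd_apply_basis, LinearMap.zero_apply]
      rcases hdeg σ with h0 | h1
      · rw [h0, Int.cast_zero, zero_smul]
      · exact absurd h1 (h σ)
    rw [hEdef, hP0, zero_mul, zero_mul]
  have hx : e σ₁ ∈ H.piece 1 0 := by
    have h := basis_mem_piece_of_graded H e hF hFc σ₁
    rw [hσ₁, sub_self] at h
    exact h
  obtain ⟨r, hr, hre⟩ := ψ.pos 1 0 (by norm_num) (e σ₁) hx (e.ne_zero σ₁)
  have hψne : ψ.form.baseChange ℂ (e σ₁) (conj (e σ₁)) ≠ 0 := by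
    intro h0
    rw [h0, mul_zero] at hre
    have : (r : ℂ) = 0 := hre.symm
    exact hr.ne' (by exact_mod_cast this)
  -- `Z - W = ((c₀ + c₁)/2) • 1` is skew
  have hskewZ := ThetaSubalgebra.formBaseChange_add_eq_zero_of_mem_spanC ψ hskew hZ (e σ₁) (conj (e σ₁))
  have hskewW : ψ.form.baseChange ℂ (W (e σ₁)) (conj (e σ₁)) + ψ.form.baseChange ℂ (e σ₁) (W (conj (e σ₁))) = 0 := by
    rw [formBaseChange_skew_of_mem_hodgeLieC ψ hWM, neg_add_cancel]
  have hsum : (c 0 + c 1) * ψ.form.baseChange ℂ (e σ₁) (conj (e σ₁)) = 0 := by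
    have h1 : ψ.form.baseChange ℂ (Z (e σ₁)) (conj (e σ₁)) =
        ((c 0 + c 1) / 2) * ψ.form.baseChange ℂ (e σ₁) (conj (e σ₁)) +
          ψ.form.baseChange ℂ (W (e σ₁)) (conj (e σ₁)) := by
      rw [hZW', map_add, LinearMap.add_apply, map_smul, LinearMap.smul_apply, smul_eq_mul]
    have h2 : ψ.form.baseChange ℂ (e σ₁) (Z (conj (e σ₁))) =
        ((c 0 + c 1) / 2) * ψ.form.baseChange ℂ (e σ₁) (conj (e σ₁)) +
          ψ.form.baseChange ℂ (e σ₁) (W (conj (e σ₁))) := by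
      rw [hZW', map_add, map_smul, smul_eq_mul]
    rw [h1, h2] at hskewZ
    linear_combination hskewZ - hskewW
  have hc01 : c 1 = -c 0 := by
    have h := (mul_eq_zero.1 hsum).resolve_right hψne
    linear_combination h
  refine ⟨![c 0, c 2, c 3], ?_⟩
  simp only [Matrix.cons_val_zero, Matrix.cons_val_one, Matrix.cons_val]
  rw [hc, hc01, smul_sub, smul_sub, smul_smul, neg_smul]
  module


end HodgeStructure

end Literature.AlgebraicGeometry.Motives

end
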